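import Mathlib
import Summits.Ventures.PercRepro2.SPNormalForm
import Summits.Ventures.PercRepro2.TablePackage3

/-! # Normal forms: shape and size
(seat mine-b, cell pub-perc-repro2; MINE-B.md §26.7)

`SP.IsNF` describes the image of `SP.nf`: a free edge, or a left-nested series (parallel)
composition of at least two factors that are themselves normal, not series (parallel) nodes, and
listed in non-decreasing `SP.le` order.  `SP.isNF_nf`: the normal form of a free-edge term is normal;
`SP.nfree_nf`: it has the same number of edges. -/

namespace Summit.Ventures.PercRepro2.V2Closure

open Summit.Ventures.PercRepro2.UHClosure

/-- a term of free edges only -/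
def SP.IsFree : SP → Prop
  | .free => True
  | .pin => False
  | .absent => False
  | .ser s t => s.IsFree ∧ t.IsFree
  | .par s t => s.IsFree ∧ t.IsFree

/-- is the root a series node -/
def SP.isSer : SP → Bool
  | .ser _ _ => true
  | _ => false

/-- is the root a parallel node -/
def SP.isPar : SP → Bool
  | .par _ _ => true
  | _ => false

/-- `SP.le` as a relation -/
abbrev SP.le' (s t : SP) : Prop := SP.le s t = true

/-- **normal terms**: a free edge, or a left-nested composition of ≥ 2 normal factors of the other
kind, listed in non-decreasing order -/
inductive SP.IsNF : SP → Prop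
  | free : SP.IsNF .free
  | ser (a : SP) (l : List SP) (hl : l ≠ []) (hs : (a :: l).Pairwise SP.le')
      (hn : ∀ x, x ∈ a :: l → SP.IsNF x) (hk : ∀ x, x ∈ a :: l → x.isSer = false) :
      SP.IsNF (SP.serL a l)
  | par (a : SP) (l : List SP) (hl : l ≠ []) (hs : (a :: l).Pairwise SP.le')
      (hn : ∀ x, x ∈ a :: l → SP.IsNF x) (hk : ∀ x, x ∈ a :: l → x.isPar = false) :
      SP.IsNF (SP.parL a l)

/-- the series factors of a non-series term -/
theorem SP.serFactors_of_isSer_false {s : SP} (h : s.isSer = false) : s.serFactors = [s] := by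
  cases s <;> simp_all [SP.isSer, SP.serFactors]

/-- the parallel factors of a non-parallel term -/
theorem SP.parFactors_of_isPar_false {s : SP} (h : s.isPar = false) : s.parFactors = [s] := by
  cases s <;> simp_all [SP.isPar, SP.parFactors]

/-- the series factors of a left-nested composition -/
theorem SP.serFactors_serL (a : SP) (l : List SP) :
    (SP.serL a l).serFactors = a.serFactors ++ l.flatMap SP.serFactors := by
  induction l generalizing a with
  | nil => simp [SP.serL]
  | cons b l ih =>
    rw [SP.serL_cons, ih]
    simp [SP.serFactors, List.flatMap_cons, List.append_assoc]

/-- the parallel factors of a left-nested composition -/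
theorem SP.parFactors_parL (a : SP) (l : List SP) :
    (SP.parL a l).parFactors = a.parFactors ++ l.flatMap SP.parFactors := by
  induction l generalizing a with
  | nil => simp [SP.parL]
  | cons b l ih =>
    rw [SP.parL_cons, ih]
    simp [SP.parFactors, List.flatMap_cons, List.append_assoc]

/-- a left-nested series composition of ≥ 2 factors is a series node -/
theorem SP.isSer_serL (a : SP) {l : List SP} (hl : l ≠ []) : (SP.serL a l).isSer = true := by
  obtain ⟨b, l, rfl⟩ := List.exists_cons_of_ne_nil hl
  clear hl
  induction l generalizing a b with
  | nil => rfl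
  | cons c l ih => exact ih (SP.ser a b) c

/-- a left-nested parallel composition of ≥ 2 factors is a parallel node -/
theorem SP.isPar_parL (a : SP) {l : List SP} (hl : l ≠ []) : (SP.parL a l).isPar = true := by
  obtain ⟨b, l, rfl⟩ := List.exists_cons_of_ne_nil hl
  clear hl
  induction l generalizing a b with
  | nil => rfl
  | cons c l ih => exact ih (SP.par a b) c

/-- a series node is not a parallel node, whatever its factors -/
theorem SP.isPar_serL (a : SP) {l : List SP} (hl : l ≠ []) : (SP.serL a l).isPar = false := by
  obtain ⟨b, l, rfl⟩ := List.exists_cons_of_ne_nil hl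
  clear hl
  induction l generalizing a b with
  | nil => rfl
  | cons c l ih => exact ih (SP.ser a b) c

/-- a parallel node is not a series node -/
theorem SP.isSer_parL (a : SP) {l : List SP} (hl : l ≠ []) : (SP.parL a l).isSer = false := by
  obtain ⟨b, l, rfl⟩ := List.exists_cons_of_ne_nil hl
  clear hl
  induction l generalizing a b with
  | nil => rfl
  | cons c l ih => exact ih (SP.par a b) c

/-- the flattened series factors of a list of non-series terms is the list itself -/
theorem SP.flatMap_serFactors_eq {l : List SP} (h : ∀ x ∈ l, x.isSer = false) :
    l.flatMap SP.serFactors = l := by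
  induction l with
  | nil => rfl
  | cons x l ih =>
    rw [List.flatMap_cons, SP.serFactors_of_isSer_false (h x (List.mem_cons_self ..)),
      ih (fun y hy => h y (List.mem_cons_of_mem x hy))]
    rfl

/-- the flattened parallel factors of a list of non-parallel terms is the list itself -/
theorem SP.flatMap_parFactors_eq {l : List SP} (h : ∀ x ∈ l, x.isPar = false) :
    l.flatMap SP.parFactors = l := by
  induction l with
  | nil => rfl
  | cons x l ih =>
    rw [List.flatMap_cons, SP.parFactors_of_isPar_false (h x (List.mem_cons_self ..)),
      ih (fun y hy => h y (List.mem_cons_of_mem x hy))]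
    rfl

/-- the series factors of a normal series term are its own factor list -/
theorem SP.serFactors_serL_of_isSer_false (a : SP) (l : List SP)
    (hn : ∀ x ∈ a :: l, x.isSer = false) : (SP.serL a l).serFactors = a :: l := by
  rw [SP.serFactors_serL, SP.serFactors_of_isSer_false (hn a (List.mem_cons_self ..)),
    SP.flatMap_serFactors_eq (fun y hy => hn y (List.mem_cons_of_mem a hy))]
  rfl

/-- the parallel factors of a normal parallel term are its own factor list -/
theorem SP.parFactors_parL_of_isPar_false (a : SP) (l : List SP)
    (hn : ∀ x ∈ a :: l, x.isPar = false) : (SP.parL a l).parFactors = a :: l := by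
  rw [SP.parFactors_parL, SP.parFactors_of_isPar_false (hn a (List.mem_cons_self ..)),
    SP.flatMap_parFactors_eq (fun y hy => hn y (List.mem_cons_of_mem a hy))]
  rfl

/-- **the series factors of a normal term are normal and not series nodes** -/
theorem SP.IsNF.serFactors_spec {u : SP} (h : SP.IsNF u) :
    ∀ x ∈ u.serFactors, SP.IsNF x ∧ x.isSer = false := by
  cases h with
  | free => intro x hx; simp [SP.serFactors] at hx; subst hx; exact ⟨SP.IsNF.free, rfl⟩
  | ser a l hl hs hn hk =>
    intro x hx
    rw [SP.serFactors_serL_of_isSer_false a l hk] at hx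
    exact ⟨hn x hx, hk x hx⟩
  | par a l hl hs hn hk =>
    intro x hx
    rw [SP.serFactors_of_isSer_false (SP.isSer_parL a hl)] at hx
    simp at hx; subst hx
    exact ⟨SP.IsNF.par a l hl hs hn hk, SP.isSer_parL a hl⟩

/-- **the parallel factors of a normal term are normal and not parallel nodes** -/
theorem SP.IsNF.parFactors_spec {u : SP} (h : SP.IsNF u) :
    ∀ x ∈ u.parFactors, SP.IsNF x ∧ x.isPar = false := by
  cases h with
  | free => intro x hx; simp [SP.parFactors] at hx; subst hx; exact ⟨SP.IsNF.free, rfl⟩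
  | par a l hl hs hn hk =>
    intro x hx
    rw [SP.parFactors_parL_of_isPar_false a l hk] at hx
    exact ⟨hn x hx, hk x hx⟩
  | ser a l hl hs hn hk =>
    intro x hx
    rw [SP.parFactors_of_isPar_false (SP.isPar_serL a hl)] at hx
    simp at hx; subst hx
    exact ⟨SP.IsNF.ser a l hl hs hn hk, SP.isPar_serL a hl⟩
/-- `SP.le` is transitive, in the form `List.pairwise_mergeSort` wants -/
theorem SP.le_trans' : ∀ a b c : SP, SP.le a b = true → SP.le b c = true → SP.le a c = true :=
  fun _ _ _ h₁ h₂ => SP.le_trans h₁ h₂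

/-- `SP.le` is total, in the form `List.pairwise_mergeSort` wants -/
theorem SP.le_total' : ∀ a b : SP, (SP.le a b || SP.le b a) = true := SP.le_total

/-- equivalent terms have the same number of free edges -/
theorem SP.Equiv.nfree_eq {s t : SP} (h : SP.Equiv s t) : s.nfree = t.nfree := by
  induction h with
  | refl s => rfl
  | symm _ ih => exact ih.symm
  | trans _ _ ih₁ ih₂ => exact ih₁.trans ih₂
  | ser_comm s t => exact Nat.add_comm _ _
  | par_comm s t => exact Nat.add_comm _ _
  | ser_assoc s t u => exact Nat.add_assoc _ _ _
  | par_assoc s t u => exact Nat.add_assoc _ _ _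
  | ser_congr _ _ ih₁ ih₂ => show _ + _ = _ + _; rw [ih₁, ih₂]
  | par_congr _ _ ih₁ ih₂ => show _ + _ = _ + _; rw [ih₁, ih₂]

/-- **the normal form of a term has the same number of free edges** -/
theorem SP.nfree_nf (s : SP) : s.nf.nfree = s.nfree := (SP.Equiv.nf s).nfree_eq.symm

/-- **the normal form of a free-edge term is normal** -/
theorem SP.isNF_nf (s : SP) (hs : s.IsFree) : s.nf.IsNF := by
  induction s with
  | free => exact SP.IsNF.free
  | pin => exact hs.elim
  | absent => exact hs.elim
  | ser s t ihs iht =>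
    obtain ⟨hfs, hft⟩ := hs
    have hA := (ihs hfs).serFactors_spec
    have hB := (iht hft).serFactors_spec
    obtain ⟨a, la, ha⟩ := List.exists_cons_of_ne_nil (SP.serFactors_ne_nil s.nf)
    obtain ⟨b, lb, hb⟩ := List.exists_cons_of_ne_nil (SP.serFactors_ne_nil t.nf)
    have hperm := List.mergeSort_perm (s.nf.serFactors ++ t.nf.serFactors) SP.le
    have hlen := List.length_mergeSort (le := SP.le) (s.nf.serFactors ++ t.nf.serFactors)
    have hsorted := List.pairwise_mergeSort SP.le_trans' SP.le_total' (s.nf.serFactors ++ t.nf.serFactors)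
    have hne : (s.nf.serFactors ++ t.nf.serFactors).mergeSort SP.le ≠ [] := by
      intro h0; rw [h0, ha] at hlen; simp at hlen
    obtain ⟨c, lc, hc⟩ := List.exists_cons_of_ne_nil hne
    show SP.IsNF (SP.serOfList ((s.nf.serFactors ++ t.nf.serFactors).mergeSort SP.le))
    rw [hc]
    show SP.IsNF (SP.serL c lc)
    rw [hc] at hperm hlen hsorted
    refine SP.IsNF.ser c lc ?_ hsorted ?_ ?_
    · intro h0; rw [h0, ha, hb] at hlen; simp at hlen
    · intro x hx
      rcases List.mem_append.1 (hperm.subset hx) with h | h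
      · exact (hA x h).1
      · exact (hB x h).1
    · intro x hx
      rcases List.mem_append.1 (hperm.subset hx) with h | h
      · exact (hA x h).2
      · exact (hB x h).2
  | par s t ihs iht =>
    obtain ⟨hfs, hft⟩ := hs
    have hA := (ihs hfs).parFactors_spec
    have hB := (iht hft).parFactors_spec
    obtain ⟨a, la, ha⟩ := List.exists_cons_of_ne_nil (SP.parFactors_ne_nil s.nf)
    obtain ⟨b, lb, hb⟩ := List.exists_cons_of_ne_nil (SP.parFactors_ne_nil t.nf)
    have hperm := List.mergeSort_perm (s.nf.parFactors ++ t.nf.parFactors) SP.le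
    have hlen := List.length_mergeSort (le := SP.le) (s.nf.parFactors ++ t.nf.parFactors)
    have hsorted := List.pairwise_mergeSort SP.le_trans' SP.le_total' (s.nf.parFactors ++ t.nf.parFactors)
    have hne : (s.nf.parFactors ++ t.nf.parFactors).mergeSort SP.le ≠ [] := by
      intro h0; rw [h0, ha] at hlen; simp at hlen
    obtain ⟨c, lc, hc⟩ := List.exists_cons_of_ne_nil hne
    show SP.IsNF (SP.parOfList ((s.nf.parFactors ++ t.nf.parFactors).mergeSort SP.le))
    rw [hc]
    show SP.IsNF (SP.parL c lc)
    rw [hc] at hperm hlen hsorted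
    refine SP.IsNF.par c lc ?_ hsorted ?_ ?_
    · intro h0; rw [h0, ha, hb] at hlen; simp at hlen
    · intro x hx
      rcases List.mem_append.1 (hperm.subset hx) with h | h
      · exact (hA x h).1
      · exact (hB x h).1
    · intro x hx
      rcases List.mem_append.1 (hperm.subset hx) with h | h
      · exact (hA x h).2
      · exact (hB x h).2

/-- the normal form of a free-edge term is a free-edge term -/
theorem SP.isFree_nf (s : SP) (hs : s.IsFree) : s.nf.IsFree := by
  have key : ∀ {u v : SP}, SP.Equiv u v → (u.IsFree ↔ v.IsFree) := by
    intro u v h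
    induction h with
    | refl s => exact Iff.rfl
    | symm _ ih => exact ih.symm
    | trans _ _ ih₁ ih₂ => exact ih₁.trans ih₂
    | ser_comm s t => exact And.comm
    | par_comm s t => exact And.comm
    | ser_assoc s t u => exact and_assoc
    | par_assoc s t u => exact and_assoc
    | ser_congr _ _ ih₁ ih₂ => exact and_congr ih₁ ih₂
    | par_congr _ _ ih₁ ih₂ => exact and_congr ih₁ ih₂
  exact (key (SP.Equiv.nf s)).1 hs


end Summit.Ventures.PercRepro2.V2Closure
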